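import Summits.BirchSwinnertonDyer.BirchSwinnertonDyer.Theorems.KatoDescentPotSupersingularReducibleH2DescentCount
import Summits.BirchSwinnertonDyer.BirchSwinnertonDyer.Theorems.KatoDescentPotSupersingularExactFineControlRows
import HarnessLib

/-!
# KATO'S THM. 14.5 (3) AT LEVEL `0` ON THE TAME REDUCIBLE ROWS, strict-Selmer form:
# `#Sel_str(ℚ, W[p^∞]) ∣ [H¹(ℤ[1/p], T_pW) : ℤ_p·𝐲₀]` modulo {H2X, Z0, 13.4, Serre, FW, Lim 3.5}, with the local
# hypothesis `W(ℚ_p)[p] = 0` DISCHARGED on every additive `p ≥ 11` and on `p ∈ {5,7}` off Kodaira II/III (crux M 19196)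

Seat `bsd-potss-rkm` g28 (prover, cell `bsd-potss`), item stmt-BirchSwinnertonDyer-19196 `ReducibleKatoMember`
(`--supports … --as helper`; route-free; closes nothing).  Sequel of `…ReducibleH2DescentCount` (same namespace), which proves
`#Sel₀(ℚ_∞, W[p^∞])^Γ ∣ [H¹(ℤ[1/p], T_pW) : ℤ_p·𝐲₀]` on the reducible non-CM rank-0 rows from a descent package containing
`X₀` (the fact H2X).  Here g27's EXACT FINE CONTROL `#Sel_str(ℚ, W[p^∞]) = #Sel₀(ℚ_∞, W[p^∞])^Γ` on the rows with
`W(ℚ_p)[p] = 0` (`ExactFineControl.natCard_katoStrictSelmer_eq_natCard_fineSelmerInfty_invariants`) turns it into the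
statement about Kato's strict Selmer group `Sel_str(ℚ, W[p^∞]) = katoStrictSelmer W p {v_p}` ((14.9.3): unramified off `p`,
trivial at `p`) — whose order is `#H²(ℤ[1/p], T_pW)` on these rows ((14.14.2) + (14.9.3), `#W(ℚ)[p^∞] = #W(ℚ_p)[p^∞] = 1`;
clause (c2′) `KatoH2CountAt` of the held package 27962, `ExactFineControl.katoH2CountAt_iff_eq_natCard_katoStrictSelmer`).
Printed shape (Thm. 14.5 (3), p. 236): "`#(H²(ℤ[1/p],T)) ≤ [H¹(ℤ[1/p],T) : z]`", here with Thm. 13.4 + Serre in place of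
(12.5.1) on the reducible rows and the `(c,d)`-zeta class `𝐲` in place of `z_γ`.

* `exists_zetaLift_natCard_katoStrictSelmer_dvd_index_of_noPTorsionPadic` (the `∃`-form over the six facts),
  `natCard_katoStrictSelmer_dvd_index_zetaLift_of_noPTorsionPadic` (ON THE LIFT of a value-guarded `ZetaBody` family — the
  binder under which 27962 speaks of `𝐲`), `exists_zetaLift_dvd_index_of_katoH2CountAt_of_noPTorsionPadic` ((c2′)'s number
  divides Kato's index), rows `…_of_addv_of_eleven_le` (EVERY additive `p ≥ 11`: all (t′) rows of K8-t′), `…_of_addv`.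

HONEST FRAMING: BSD is not proved by any of this; nothing is booked; crux M stays cite-level on {modularity, HELD 27962};
theorems only (no definition, no named fact, no `sorry`).  WHAT THIS IS NOT: the local index of `𝐲₀` at `p` ((b′)) and the
Poitou–Tate ledger to `Ш`/Tamagawa are not touched (sequel `…ReducibleTameShaBound`); the count is one-sided.

References: K. Kato, Astérisque 295 (2004), Thm. 13.4 (p. 226), Thm. 14.5 (p. 236), (14.9.1)–(14.9.3) (pp. 239–240), §14.14
(14.14.1)–(14.14.2) and Lemma 14.15 (pp. 243–244) [Kato2004Asterisque]; R. Greenberg, LNM 1716 (1999) §3 Prop. 3.8, §4 Lemma 4.2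
[GreenbergLNM1716]; B. Mazur, IHÉS 47 (1977) Ch. III §5 [Mazur1977].
-/

-- the summit and its single problem are both named `BirchSwinnertonDyer` (registry layout D-0017)
set_option linter.dupNamespace false
set_option autoImplicit false

noncomputable section

open scoped Classical NumberField TensorProduct
open Function Field NumberField IsDedekindDomain WeierstrassCurve CongruenceSubgroup
open Literature.NumberTheory.EllipticCurves Literature.NumberTheory.EllipticCurves.GreenbergSelmer
open Literature.NumberTheory.GaloisRepresentations
open Literature.NumberTheory.EllipticCurves.ModularForms
open Literature.NumberTheory.EllipticCurves.Kato2004 Literature.NumberTheory.EllipticCurves.Kato2004.EulerSystemValues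
open Literature.NumberTheory.EllipticCurves.IwasawaAlgebra Literature.NumberTheory.EllipticCurves.IwasawaDual
open Literature.NumberTheory.EllipticCurves.Rank1Residual
open Summit.BirchSwinnertonDyer.Rank1Residual
open Summit.BirchSwinnertonDyer.BirchSwinnertonDyer.Theorems

namespace Summit.BirchSwinnertonDyer.BirchSwinnertonDyer.Theorems.ReducibleH2DescentCount

/-! ## §4 With exact fine control: `#Sel_str(ℚ, W[p^∞]) ∣ [H¹(ℤ[1/p], T_pW) : ℤ_p·𝐲₀]` on the tame rows -/

section Strict

variable (W : WeierstrassCurve ℚ) [W.IsElliptic] (p : ℕ) [Fact p.Prime]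
  [ContinuousSMul ℤ_[p] (W.tateModule p)] [Module.Free ℤ_[p] (W.tateModule p)]
  [Module.Finite ℤ_[p] (W.tateModule p)]
  [Finite W.toAffine.Point] [Finite (AddCommGroup.primaryComponent W.sha p)]
  {κ : ZpExtension ℚ p} {γ : absoluteGaloisGroup ℚ}

/-- **KATO THM. 14.5 (3) AT LEVEL `0` ON THE TAME REDUCIBLE ROWS, FROM ATOMIC FACTS: `#Sel_str(ℚ, W[p^∞]) ∣
[H¹(ℤ[1/p], T_pW) : ℤ_p·𝐲₀]`.**  On a reducible non-CM rank-0 row with `L(W,1) ≠ 0` and `W(ℚ_p)[p] = 0` (`p ≠ 2`), for the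
cyclotomic `(κ, γ)` and every pin `I`: there is a non-zero genuine Euler-system class `𝐲 ∈ 𝐇¹_Γ(T_pW)` (Kato's `(c,d)`-zeta
lift) with `𝐲₀` of infinite order and `H¹(ℤ[1/p],T_pW)/ℤ_p 𝐲₀` finite such that the order of Kato's strict Selmer group
`Sel_str(ℚ, W[p^∞]) = katoStrictSelmer W p {v_p}` ((14.9.3): unramified off `p`, trivial at `p`; `= #H²(ℤ[1/p],T_pW)` on
these rows by (14.14.2) + (14.9.3), `#W(ℚ)[p^∞] = #W(ℚ_p)[p^∞] = 1`) DIVIDES Kato's index `[H¹(ℤ[1/p],T_pW) : ℤ_p 𝐲₀]`.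
Printed shape: "`#(H²(ℤ[1/p],T)) ≤ [H¹(ℤ[1/p],T) : z]`" (Thm. 14.5 (3), with Thm. 13.4 + Serre for (12.5.1) on the
reducible rows).  Modulo the six named facts {H2X, Z0, 13.4, Serre, FW, Lim 3.5}; exact control `#Sel_str = #Sel₀(ℚ_∞)^Γ`
is the kernel theorem of seat g27. [cite: Kato2004Asterisque, Thm. 14.5 (3) (p. 236), (14.9.3) (p. 240), §14.14 (14.14.1)–(14.14.2) and Lemma 14.15 (pp. 243–244)]
[cite: GreenbergLNM1716, §3 Prop. 3.8, §4 Lemma 4.2] [cite: Wuthrich2014, Lemma 14 (p. 396)] -/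
theorem exists_zetaLift_natCard_katoStrictSelmer_dvd_index_of_noPTorsionPadic
    (hX : exists_iwasawaH2Data_fineSelmerDual_embedding)
    (hZ0 : exists_member_eulerSystem_expStar_values)
    (h134 : thm13_4_lengthAt_fineSelmerDual_le_of_isEulerSystemClass)
    (hSerre : serre_adicImage_contains_congruenceSubgroup)
    (hLim : Lim2017.thm35_fineSelmerDual_moduleFinite_of_classicalMuVanishes_of_le_divisionField)
    (hFW : Literature.NumberTheory.IwasawaTheory.ferreroWashington1979_classicalMuVanishes)
    (hp : p ≠ 2) (hκ : κ.IsCyclotomic) (hγ : κ.IsTopGenerator γ) (hCM : ¬ W.HasCM)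
    (hred : ¬ W.HasIrreducibleModPGaloisRep p)
    (h4 : ∀ R : (W.baseChange ℚ_[p]).toAffine.Point, p • R = 0 → R = 0)
    (I : IwasawaH1Data W p κ γ) {N : ℕ} [NeZero N] (f : CuspForm (Gamma0 N) 2) (hf : IsNewformOf W f)
    (hL1 : W.entireLFunction 1 ≠ 0) (ι : (m : ℕ) → (CyclotomicField m ℚ →+* ℂ)) :
    ∃ y : I.H, y ≠ 0 ∧ IsEulerSystemClass W p κ γ I y ∧ ¬ IsOfFinAddOrder (I.proj 0 y) ∧
      Finite (integralH1 (tateRep W p) p (κ.layerSubgroup 0) ⧸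
        Submodule.span ℤ_[p] {(⟨I.proj 0 y, I.proj_mem 0 y⟩ : integralH1 (tateRep W p) p (κ.layerSubgroup 0))}) ∧
      Nat.card (katoStrictSelmer W p {primePlace p}) ∣
        Nat.card (integralH1 (tateRep W p) p (κ.layerSubgroup 0) ⧸
          Submodule.span ℤ_[p] {(⟨I.proj 0 y, I.proj_mem 0 y⟩ :
            integralH1 (tateRep W p) p (κ.layerSubgroup 0))}) := by
  obtain ⟨y, hy0, hES, hnt, -, hfi, hdvd⟩ :=
    exists_zetaLift_natCard_fineSelmer_invariants_dvd_index_of_noPTorsionPadic W p hX hZ0 h134 hSerre hLim hFW hp hκ hγ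
      hCM hred h4 I f hf hL1 ι
  refine ⟨y, hy0, hES, hnt, hfi, ?_⟩
  rw [ExactFineControl.natCard_katoStrictSelmer_eq_natCard_fineSelmerInfty_invariants W κ hp hκ hγ h4]
  exact hdvd

/-- **The consumable form ON THE LIFT with `W(ℚ_p)[p] = 0` displayed: for a value-guarded `ZetaBody` family and its Λ-adic lift `𝐲`,
`#Sel_str(ℚ, W[p^∞]) ∣ [H¹(ℤ[1/p], T_pW) : ℤ_p·𝐲₀]`** (finite), modulo {H2X, 13.4, Serre, FW, Lim 3.5} — the theorem a holder of a
(b′)-type statement about THIS `𝐲₀` consumes (sequel file `…ReducibleTameShaBound`).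
[cite: Kato2004Asterisque, Thm. 12.5 (p. 221), Thm. 14.5 (2)–(3) (p. 236), (14.9.3) (p. 240), §14.14 (pp. 243–244)] [cite: GreenbergLNM1716, §3 Prop. 3.8, §4 Lemma 4.2] -/
theorem natCard_katoStrictSelmer_dvd_index_zetaLift_of_noPTorsionPadic
    (hX : exists_iwasawaH2Data_fineSelmerDual_embedding)
    (h134 : thm13_4_lengthAt_fineSelmerDual_le_of_isEulerSystemClass)
    (hSerre : serre_adicImage_contains_congruenceSubgroup)
    (hLim : Lim2017.thm35_fineSelmerDual_moduleFinite_of_classicalMuVanishes_of_le_divisionField)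
    (hFW : Literature.NumberTheory.IwasawaTheory.ferreroWashington1979_classicalMuVanishes)
    (hp : p ≠ 2) (hκ : κ.IsCyclotomic) (hγ : κ.IsTopGenerator γ) (hCM : ¬ W.HasCM)
    (hred : ¬ W.HasIrreducibleModPGaloisRep p)
    (h4 : ∀ R : (W.baseChange ℚ_[p]).toAffine.Point, p • R = 0 → R = 0)
    (I : IwasawaH1Data W p κ γ) {N : ℕ} [NeZero N] {f : CuspForm (Gamma0 N) 2}
    {ι : (m : ℕ) → (CyclotomicField m ℚ →+* ℂ)} {κ' : ℝ}
    {Λ' : ∀ (k : ℕ) (r : Finset (HeightOneSpectrum (𝓞 ℚ))),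
      H1 (tateRep W p) (cycSubgroup p k r) →ₗ[ℤ_[p]] ℚ_[p] ⊗[ℚ] CyclotomicField (cycLevel p k r) ℚ}
    {c d a : ℤ} {A : ℕ}
    {z : ∀ (k : ℕ) (r : (cyclotomicLevelsRat p (badPlaces c d A N)).Ideals),
      H1 (tateRep W p) ((cyclotomicLevelsRat p (badPlaces c d A N)).level k r.1)}
    {x : ∀ (k : ℕ) (r : (cyclotomicLevelsRat p (badPlaces c d A N)).Ideals),
      CyclotomicField (cycLevel p k r.1) ℚ}
    (hbody : ZetaBody W p f ι κ' Λ' c d a A z x) (hne : 2 * c.natAbs * d.natAbs * A * N ≠ 0)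
    {y : I.H} (hy : ∀ n : ℕ, I.proj n y = levelToLayer W p hκ hp (badPlaces c d A N) n
      (z (n + 1) (cyclotomicLevelsRat p (badPlaces c d A N)).idealOne))
    {V : WeierstrassCurve ℚ} [V.IsElliptic] (hf : IsNewformOf V f) (hL1 : V.entireLFunction 1 ≠ 0)
    (hκ' : κ' ≠ 0) (hA : 0 < A) (d' : ℤ) (hcd : Int.gcd (c * d) A = 1) (hdd' : d * d' ≡ 1 [ZMOD (A : ℤ)])
    (hR : cuspFactor f true (fun _ ↦ 1) c d a A d' ≠ 0) :
    Finite (integralH1 (tateRep W p) p (κ.layerSubgroup 0) ⧸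
        Submodule.span ℤ_[p] {(⟨I.proj 0 y, I.proj_mem 0 y⟩ : integralH1 (tateRep W p) p (κ.layerSubgroup 0))}) ∧
      Nat.card (katoStrictSelmer W p {primePlace p}) ∣
        Nat.card (integralH1 (tateRep W p) p (κ.layerSubgroup 0) ⧸
          Submodule.span ℤ_[p] {(⟨I.proj 0 y, I.proj_mem 0 y⟩ :
            integralH1 (tateRep W p) p (κ.layerSubgroup 0))}) := by
  obtain ⟨-, hfi, hdvd⟩ := natCard_fineSelmer_invariants_dvd_index_zetaLift_of_H2X W p hX h134 hSerre hLim hFW hp hκ hγ hCM hred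
    (primePlace p) (coe_primesEquiv_primePlace p)
    (TowerTorsionVanishing.finite_fixedPoints_kerSubgroup_inf_decomp_of_noPTorsionPadic W p κ (primePlace p)
      (coe_primesEquiv_primePlace p) h4) I hbody hne hy hf hL1 hκ' hA d' hcd hdd' hR
  refine ⟨hfi, ?_⟩
  rw [ExactFineControl.natCard_katoStrictSelmer_eq_natCard_fineSelmerInfty_invariants W κ hp hκ hγ h4]
  exact hdvd

/-- **Clause (c2′) of the held core package read on these rows: every `n` with `KatoH2CountAt W p n` (the order
`#(𝐇²/X𝐇²) = #H²(ℤ[1/p],T_pW)` as (14.14.2) + (14.9.3) count it; `= #Sel_str` when `W(ℚ_p)[p] = 0`, g27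
`katoH2CountAt_iff_eq_natCard_katoStrictSelmer`) DIVIDES Kato's index `[H¹(ℤ[1/p],T_pW) : ℤ_p 𝐲₀]`** — Thm. 14.5 (3)
verbatim-shape on the tame reducible rows, atomic-fact form. [cite: Kato2004Asterisque, Thm. 14.5 (3) (p. 236), (14.9.3) (p. 240), (14.14.2) (p. 243)] -/
theorem exists_zetaLift_dvd_index_of_katoH2CountAt_of_noPTorsionPadic
    (hX : exists_iwasawaH2Data_fineSelmerDual_embedding)
    (hZ0 : exists_member_eulerSystem_expStar_values)
    (h134 : thm13_4_lengthAt_fineSelmerDual_le_of_isEulerSystemClass)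
    (hSerre : serre_adicImage_contains_congruenceSubgroup)
    (hLim : Lim2017.thm35_fineSelmerDual_moduleFinite_of_classicalMuVanishes_of_le_divisionField)
    (hFW : Literature.NumberTheory.IwasawaTheory.ferreroWashington1979_classicalMuVanishes)
    (hp : p ≠ 2) (hκ : κ.IsCyclotomic) (hγ : κ.IsTopGenerator γ) (hCM : ¬ W.HasCM)
    (hred : ¬ W.HasIrreducibleModPGaloisRep p)
    (h4 : ∀ R : (W.baseChange ℚ_[p]).toAffine.Point, p • R = 0 → R = 0)
    (I : IwasawaH1Data W p κ γ) {N : ℕ} [NeZero N] (f : CuspForm (Gamma0 N) 2) (hf : IsNewformOf W f)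
    (hL1 : W.entireLFunction 1 ≠ 0) (ι : (m : ℕ) → (CyclotomicField m ℚ →+* ℂ)) :
    ∃ y : I.H, y ≠ 0 ∧ IsEulerSystemClass W p κ γ I y ∧ ¬ IsOfFinAddOrder (I.proj 0 y) ∧
      ∀ n : ℕ, KatoH2CountAt W p n →
        n ∣ Nat.card (integralH1 (tateRep W p) p (κ.layerSubgroup 0) ⧸
          Submodule.span ℤ_[p] {(⟨I.proj 0 y, I.proj_mem 0 y⟩ :
            integralH1 (tateRep W p) p (κ.layerSubgroup 0))}) := by
  obtain ⟨y, hy0, hES, hnt, -, hdvd⟩ :=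
    exists_zetaLift_natCard_katoStrictSelmer_dvd_index_of_noPTorsionPadic W p hX hZ0 h134 hSerre hLim hFW hp hκ hγ hCM
      hred h4 I f hf hL1 ι
  refine ⟨y, hy0, hES, hnt, fun n hn ↦ ?_⟩
  rw [(ExactFineControl.katoH2CountAt_iff_eq_natCard_katoStrictSelmer W h4 n).mp hn]
  exact hdvd

/-- **On every ADDITIVE row at `p ≥ 11`** (no local hypothesis: `W(ℚ_p)[p] = 0` is a tree theorem there) — in
particular on every reducible non-CM (t′) row of K8-t′'s crux M: **`#Sel_str(ℚ, W[p^∞]) ∣ [H¹(ℤ[1/p], T_pW) : ℤ_p·𝐲₀]`**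
modulo {H2X, Z0, 13.4, Serre, FW, Lim 3.5}. [cite: Kato2004Asterisque, Thm. 14.5 (3) (p. 236), (14.9.3) (p. 240), §14.14 (pp. 243–244)]
[cite: Mazur1977, Ch. III §5, Step 1 (p. 158)] -/
theorem exists_zetaLift_natCard_katoStrictSelmer_dvd_index_of_addv_of_eleven_le [W.IsGloballyMinimal]
    (hX : exists_iwasawaH2Data_fineSelmerDual_embedding)
    (hZ0 : exists_member_eulerSystem_expStar_values)
    (h134 : thm13_4_lengthAt_fineSelmerDual_le_of_isEulerSystemClass)
    (hSerre : serre_adicImage_contains_congruenceSubgroup)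
    (hLim : Lim2017.thm35_fineSelmerDual_moduleFinite_of_classicalMuVanishes_of_le_divisionField)
    (hFW : Literature.NumberTheory.IwasawaTheory.ferreroWashington1979_classicalMuVanishes)
    (h11 : 11 ≤ p) (hadd : Addv W p) (hκ : κ.IsCyclotomic) (hγ : κ.IsTopGenerator γ) (hCM : ¬ W.HasCM)
    (hred : ¬ W.HasIrreducibleModPGaloisRep p)
    (I : IwasawaH1Data W p κ γ) {N : ℕ} [NeZero N] (f : CuspForm (Gamma0 N) 2) (hf : IsNewformOf W f)
    (hL1 : W.entireLFunction 1 ≠ 0) (ι : (m : ℕ) → (CyclotomicField m ℚ →+* ℂ)) :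
    ∃ y : I.H, y ≠ 0 ∧ IsEulerSystemClass W p κ γ I y ∧ ¬ IsOfFinAddOrder (I.proj 0 y) ∧
      Finite (integralH1 (tateRep W p) p (κ.layerSubgroup 0) ⧸
        Submodule.span ℤ_[p] {(⟨I.proj 0 y, I.proj_mem 0 y⟩ : integralH1 (tateRep W p) p (κ.layerSubgroup 0))}) ∧
      Nat.card (katoStrictSelmer W p {primePlace p}) ∣
        Nat.card (integralH1 (tateRep W p) p (κ.layerSubgroup 0) ⧸
          Submodule.span ℤ_[p] {(⟨I.proj 0 y, I.proj_mem 0 y⟩ :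
            integralH1 (tateRep W p) p (κ.layerSubgroup 0))}) :=
  exists_zetaLift_natCard_katoStrictSelmer_dvd_index_of_noPTorsionPadic W p hX hZ0 h134 hSerre hLim hFW (by omega) hκ hγ
    hCM hred (fun _ hR ↦ Additive.eq_zero_of_prime_nsmul_eq_zero_of_addv_of_eleven_le W p h11 hadd hR) I f hf hL1 ι

/-- **On an additive row at `p ≥ 5` off Kodaira II/III** (`p = 5 ⟹ v₅(c₄) ≠ 1`, `p = 7 ⟹ v₇(c₆) ≠ 1`):
`#Sel_str(ℚ, W[p^∞]) ∣ [H¹(ℤ[1/p], T_pW) : ℤ_p·𝐲₀]` modulo {H2X, Z0, 13.4, Serre, FW, Lim 3.5}.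
[cite: Kato2004Asterisque, Thm. 14.5 (3) (p. 236), (14.9.3) (p. 240), §14.14 (pp. 243–244)] [cite: Mazur1977, Ch. III §5, Step 1 (p. 158)] -/
theorem exists_zetaLift_natCard_katoStrictSelmer_dvd_index_of_addv [W.IsGloballyMinimal]
    (hX : exists_iwasawaH2Data_fineSelmerDual_embedding)
    (hZ0 : exists_member_eulerSystem_expStar_values)
    (h134 : thm13_4_lengthAt_fineSelmerDual_le_of_isEulerSystemClass)
    (hSerre : serre_adicImage_contains_congruenceSubgroup)
    (hLim : Lim2017.thm35_fineSelmerDual_moduleFinite_of_classicalMuVanishes_of_le_divisionField)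
    (hFW : Literature.NumberTheory.IwasawaTheory.ferreroWashington1979_classicalMuVanishes)
    (hp5 : 5 ≤ p) (hadd : Addv W p) (h5 : p = 5 → padicValRat p W.c₄ ≠ 1) (h7 : p = 7 → padicValRat p W.c₆ ≠ 1)
    (hκ : κ.IsCyclotomic) (hγ : κ.IsTopGenerator γ) (hCM : ¬ W.HasCM) (hred : ¬ W.HasIrreducibleModPGaloisRep p)
    (I : IwasawaH1Data W p κ γ) {N : ℕ} [NeZero N] (f : CuspForm (Gamma0 N) 2) (hf : IsNewformOf W f)
    (hL1 : W.entireLFunction 1 ≠ 0) (ι : (m : ℕ) → (CyclotomicField m ℚ →+* ℂ)) :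
    ∃ y : I.H, y ≠ 0 ∧ IsEulerSystemClass W p κ γ I y ∧ ¬ IsOfFinAddOrder (I.proj 0 y) ∧
      Finite (integralH1 (tateRep W p) p (κ.layerSubgroup 0) ⧸
        Submodule.span ℤ_[p] {(⟨I.proj 0 y, I.proj_mem 0 y⟩ : integralH1 (tateRep W p) p (κ.layerSubgroup 0))}) ∧
      Nat.card (katoStrictSelmer W p {primePlace p}) ∣
        Nat.card (integralH1 (tateRep W p) p (κ.layerSubgroup 0) ⧸
          Submodule.span ℤ_[p] {(⟨I.proj 0 y, I.proj_mem 0 y⟩ :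
            integralH1 (tateRep W p) p (κ.layerSubgroup 0))}) :=
  exists_zetaLift_natCard_katoStrictSelmer_dvd_index_of_noPTorsionPadic W p hX hZ0 h134 hSerre hLim hFW (by omega) hκ hγ
    hCM hred (fun _ hR ↦ Additive.eq_zero_of_prime_nsmul_eq_zero_of_addv W p hp5 hadd h5 h7 hR) I f hf hL1 ι

end Strict

end Summit.BirchSwinnertonDyer.BirchSwinnertonDyer.Theorems.ReducibleH2DescentCount

end
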